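import Summits.CriticalPhenomena.CardyFormulaZ2.Theses.CardySelfRefinement
import Summits.CriticalPhenomena.CardyFormulaZ2.Theorems.CardySelfRefinementLagHandOffQuadCompactness
import Summits.CriticalPhenomena.CardyFormulaZ2.Theorems.CardySelfRefinementLagHandOffTranslation
import Summits.CriticalPhenomena.CardyFormulaZ2.Theorems.CardySelfRefinementLagHandOffCovariance
import Summits.CriticalPhenomena.CardyFormulaZ2.Theorems.CardySelfRefinementLagHandOffChordal
import Summits.CriticalPhenomena.CardyFormulaZ2.Theorems.CardySelfRefinementLagHandOffLocalityPassage2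
import Summits.CriticalPhenomena.CardyFormulaZ2.Theorems.CardySelfRefinementLagHandOffDiscretisable
import Summits.CriticalPhenomena.CardyFormulaZ2.Theorems.CardySelfRefinementLagHandOffDiscreteSplitting
import Summits.CriticalPhenomena.CardyFormulaZ2.Theorems.CardySelfRefinementLagHandOffDiscreteLocality
import Summits.CriticalPhenomena.CardyFormulaZ2.Theorems.CardySelfRefinementLagHandOffLimitMarkov
import Summits.CriticalPhenomena.CardyFormulaZ2.Theorems.CardySelfRefinementLagHandOffSlitHandOffDyadic
import Summits.CriticalPhenomena.CardyFormulaZ2.Theorems.CardySelfRefinementLagHandOffLimitCurveRegularityNoTrace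
import Summits.CriticalPhenomena.CardyFormulaZ2.Theorems.LagHandOff.Negative.Structure
import HarnessLib

/-!
# `LagHandOff` (stmt-CriticalPhenomena-10268): the crux REDUCED to its two research-level cores

Line `hitting-tournament`, fifth lead seat (prover-line-stmt-CriticalPhenomena-10268-c3-0).  This
file is the DURABLE, sorry-free form of the registered skeleton
`Cruxes/LagHandOff/Lines/hitting_tournament.lean` (sha 82f786b4, seats c1/c2/c3): the whole crux
`CardySelfRefinement.LagHandOff` follows, by landed theorems only, from the two registered stubs
taken VERBATIM as hypotheses —

* R1 `stub_quadTransfer` (the E-blind JOINT quad → interface transfer on Jordan domains: one Borel,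
  exactly similarity-equivariant decoder `Ψ D : ℋ_ℂ → CurveClass ℂ` with (configuration, interface)
  → `(S, Ψ D S)` jointly in law, for every Dobrushin domain and every admissible `ℤ²`-discretisation
  family, along every positive mesh sequence on which the full-plane quad-crossing laws converge;
  Garban–Pete–Schramm 2013, arXiv:1008.1378, Question 10 p. 16 in the joint form of their Cor. 9,
  for `ℤ²` SUBSEQUENTIAL limits; in print only on `𝕋` via Camia–Newman uniqueness, Holden–Sun
  arXiv:1905.13207 Prop. 6.25), and
* R2 in any of its three registered strengths: R2′ `stub_limitMarkov` (the chordal family PINNED by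
  a quad sublimit is domain Markov in the tree's set-based sense — Werner 2007 §3.2 (2); for `ℤ²`
  sublimits nothing is in print: Smirnov ICM 2006 §4.2, GPS13 p. 16), R2″ `stub_slitHandOff`, or the
  weakest R2‴ `stub_slitHandOffDyadic` (slit identification at dyadic polygons + path regularity of
  the slit law), the implications R2‴ ⇒ R2″ ⇒ R2′ being the landed `stub_slitHandOff_of_dyadic`
  (p126575) and `stub_limitMarkov_of_core` (p122633).

Main results: `lagHandOff_of_quadTransfer_limitMarkov : R1 → R2′ → LagHandOff` (cleanest
conjecture form) and `lagHandOff_of_stubs : R1 → R2‴ → LagHandOff` (the registered skeleton, as a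
theorem).  Everything else the crux asks for is a landed theorem and is used by name: clause (i)
outright (`Negative.lagHandOff_clause_i`, p72336); one subsequence for all `(D, E)`
(`exists_mem_subseqQuadLimits_tendsto_subseq`, SS11 Cor. 1.6, p71502); chordality
(`isChordal_of_handsOff`, p72122); similarity covariance — the ONLY use of the two antecedents
`RotationInput`, `ScaleInvariantLimits` — (`stub_covarianceFromDictionary` p71518 with
`stub_translationInput` p71750); locality and target independence (`stub_localityPassage2` p74694
fed by R3a `stub_discreteLocality` p123412, R3b `stub_discreteSplitting` p118156 and the carrier
dependence forced by the Markov property); discretisability of every Dobrushin domain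
(`stub_discretisable`, p106229); a.s. no boundary tracing for every `D`
(`stub_limitCurveRegularity_noTrace`, p82328).

So the item is EXACTLY as hard as R1 ∧ R2 — two statements that are open in print for `ℤ²`
subsequential limits — and no harder; this is the Lean certificate behind the lead's
`promote-stub` hand-back (Cruxes/LagHandOff/NOTES.md, PROMOTE.md on the item).
-/

noncomputable section

open MeasureTheory Filter Set Topology
open scoped unitInterval BoundedContinuousFunction
open Literature.Probability.Percolation Literature.Probability.LatticeModels
open Literature.Probability.RandomPlanarGeometry Literature.Probability.Percolation.QuadCrossing
open Summit.CriticalPhenomena.CardyFormulaZ2.Theses.CardySelfRefinement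

namespace Summit.CriticalPhenomena.CardyFormulaZ2.Cruxes.LagHandOff.HittingTournament

open Summit.CriticalPhenomena.CardyFormulaZ2.Cruxes.LagHandOff.CrosscutDictionary

/-- **R2′ in decoder form.** If the pinned-family Markov statement R2′ holds, then for every
hands-off reading `Ψ` (Borel, joint convergence along every quad-convergent positive mesh
sequence) and every subsequential quad limit `μ`, the family `D ↦ (Ψ D)_* μ` is domain Markov:
the curve marginal of the hands-off pins it. -/
theorem isDomainMarkov_map_of_limitMarkov
    (hR2 : ∀ μ ∈ subseqQuadLimits (Set.univ : Set ℂ), ∀ P : ChordalFamily,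
      (∀ δs : ℕ → ℝ, (∀ n, 0 < δs n) → Tendsto δs atTop (𝓝 0) →
        Tendsto (fun n => z2QuadLaw (Set.univ : Set ℂ) (δs n)) atTop (𝓝 μ) →
        ∀ (D : DobrushinDomain) (E : ℝ → DiscreteDobrushin), ZdDiscretisationFamily D E →
          ∀ f : CurveClass ℂ →ᵇ ℝ,
            Tendsto (fun n => ∫ ω, f (bondInterfaceIn D (E (δs n)) ω)
              ∂(bondPercolation (zdGraph 2) half)) atTop (𝓝 (∫ γ, f γ ∂(P D)))) →
      (∀ D : DobrushinDomain, ∃ E : ℝ → DiscreteDobrushin, ZdDiscretisationFamily D E) →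
      P.IsDomainMarkov)
    (Ψ : DobrushinDomain → QuadConfig (Set.univ : Set ℂ) → CurveClass ℂ)
    (h1 : ∀ D : DobrushinDomain, Measurable (Ψ D))
    (h3 : ∀ (μ : FiniteMeasure (QuadConfig (Set.univ : Set ℂ))) (δs : ℕ → ℝ), (∀ n, 0 < δs n) →
      Tendsto δs atTop (𝓝 0) →
      Tendsto (fun n => z2QuadLaw (Set.univ : Set ℂ) (δs n)) atTop (𝓝 μ) →
      ∀ (D : DobrushinDomain) (E : ℝ → DiscreteDobrushin), ZdDiscretisationFamily D E →
        ∀ f : (QuadConfig (Set.univ : Set ℂ) × CurveClass ℂ) →ᵇ ℝ,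
          Tendsto (fun n => ∫ ω, f (z2QuadConfig (Set.univ : Set ℂ) (δs n) ω,
              bondInterfaceIn D (E (δs n)) ω) ∂(bondPercolation (zdGraph 2) half))
            atTop (𝓝 (∫ S, f (S, Ψ D S) ∂(μ : Measure (QuadConfig (Set.univ : Set ℂ))))))
    (h4 : ∀ D : DobrushinDomain, ∃ E : ℝ → DiscreteDobrushin, ZdDiscretisationFamily D E)
    {μ : FiniteMeasure (QuadConfig (Set.univ : Set ℂ))}
    (hμ : μ ∈ subseqQuadLimits (Set.univ : Set ℂ)) :
    ChordalFamily.IsDomainMarkov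
      (fun D => (μ : Measure (QuadConfig (Set.univ : Set ℂ))).map (Ψ D)) := by
  refine hR2 μ hμ _ (fun δs hpos hlim hconv D E hE f => ?_) h4
  have h := h3 μ δs hpos hlim hconv D E hE (f.compContinuous ⟨Prod.snd, continuous_snd⟩)
  change Tendsto _ atTop (𝓝 (∫ γ, f γ ∂((μ : Measure (QuadConfig (Set.univ : Set ℂ))).map (Ψ D))))
  rw [integral_map (h1 D).aemeasurable f.continuous.aestronglyMeasurable]
  simpa only [BoundedContinuousFunction.compContinuous_apply, ContinuousMap.coe_mk,
    Function.comp_apply] using h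

/-- **The domain Markov property alone makes the boundary parametrisation invisible**: with
nothing explored the remaining domain is the carrier (`remainingDomain_mk_const`), so `initial` and
`domain` give `P D' = Q D' (const a) = Q D (const a) = P D` whenever `(carrier, a, b)` agree — the
`hcar` input of `stub_localityPassage2` (cf. `eq_of_isDomainMarkov_of_carrier_eq`, crux 0698). -/
theorem map_eq_of_isDomainMarkov_of_carrier_eq {P : ChordalFamily} (h : P.IsDomainMarkov)
    {D D' : DobrushinDomain} (hc : D'.carrier = D.carrier) (h0 : D'.pt 0 = D.pt 0)
    (h1 : D'.pt 1 = D.pt 1) : P D' = P D := by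
  obtain ⟨Q, hQ⟩ := h
  rw [← hQ.initial D', ← hQ.initial D, h0]
  refine hQ.domain D' D _ _ ?_ rfl h1
  rw [← h0, remainingDomain_mk_const, h0, remainingDomain_mk_const, hc]

/-- **`LagHandOff` from R1 (`stub_quadTransfer`) and R2′ (`stub_limitMarkov`), both taken verbatim
as hypotheses; every other input a landed theorem.**  Clause (i) outright; for (ii): extract a
subsequence on which the full-plane laws converge to some `μ ∈ Λ` (SS11 Cor. 1.6), take the
transfer `Ψ` (R1) and hand over `P := (Ψ ·)_* μ`: chordal (landed, with discretisability of every
Dobrushin domain), similarity covariant (landed; the two antecedents + translation invariance),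
domain Markov (R2′), local and target independent (landed passage from R3a/R3b + carrier
dependence from Markov), non-tracing (landed regularity, for every `D`), with the convergence
clause = the curve marginal of R1. -/
theorem lagHandOff_of_quadTransfer_limitMarkov
    (hR1 : ∃ Ψ : DobrushinDomain → QuadConfig (Set.univ : Set ℂ) → CurveClass ℂ,
      (∀ D : DobrushinDomain, Measurable (Ψ D)) ∧
      (∀ (D : DobrushinDomain) (c : ℂ) (hc : c ≠ 0) (w : ℂ) (S : QuadConfig (Set.univ : Set ℂ)),
        Ψ (D.map (similarity c hc w)) (S.mapHomeomorph (similarity c hc w)) =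
          (Ψ D S).map (similarity c hc w : C(ℂ, ℂ))) ∧
      (∀ (μ : FiniteMeasure (QuadConfig (Set.univ : Set ℂ))) (δs : ℕ → ℝ), (∀ n, 0 < δs n) →
        Tendsto δs atTop (𝓝 0) →
        Tendsto (fun n => z2QuadLaw (Set.univ : Set ℂ) (δs n)) atTop (𝓝 μ) →
        ∀ (D : DobrushinDomain) (E : ℝ → DiscreteDobrushin), ZdDiscretisationFamily D E →
          ∀ f : (QuadConfig (Set.univ : Set ℂ) × CurveClass ℂ) →ᵇ ℝ,
            Tendsto (fun n => ∫ ω, f (z2QuadConfig (Set.univ : Set ℂ) (δs n) ω,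
                bondInterfaceIn D (E (δs n)) ω) ∂(bondPercolation (zdGraph 2) half))
              atTop (𝓝 (∫ S, f (S, Ψ D S) ∂(μ : Measure (QuadConfig (Set.univ : Set ℂ)))))))
    (hR2 : ∀ μ ∈ subseqQuadLimits (Set.univ : Set ℂ), ∀ P : ChordalFamily,
      (∀ δs : ℕ → ℝ, (∀ n, 0 < δs n) → Tendsto δs atTop (𝓝 0) →
        Tendsto (fun n => z2QuadLaw (Set.univ : Set ℂ) (δs n)) atTop (𝓝 μ) →
        ∀ (D : DobrushinDomain) (E : ℝ → DiscreteDobrushin), ZdDiscretisationFamily D E →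
          ∀ f : CurveClass ℂ →ᵇ ℝ,
            Tendsto (fun n => ∫ ω, f (bondInterfaceIn D (E (δs n)) ω)
              ∂(bondPercolation (zdGraph 2) half)) atTop (𝓝 (∫ γ, f γ ∂(P D)))) →
      (∀ D : DobrushinDomain, ∃ E : ℝ → DiscreteDobrushin, ZdDiscretisationFamily D E) →
      P.IsDomainMarkov) :
    LagHandOff := by
  intro hRot hScale
  refine ⟨fun D E hE =>
    Summit.CriticalPhenomena.CardyFormulaZ2.Theorems.LagHandOff.Negative.lagHandOff_clause_i D E hE,
    fun δs hpos hlim => ?_⟩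
  -- one subsequence at the quad level (SS11 Cor. 1.6, landed)
  obtain ⟨φ, hφ, μ, hμ, hconv⟩ := exists_mem_subseqQuadLimits_tendsto_subseq δs hpos hlim
  haveI : IsProbabilityMeasure (μ : Measure (QuadConfig (Set.univ : Set ℂ))) :=
    isProbabilityMeasure_of_isSubseqQuadLimit isOpen_univ hμ
  -- the transfer (R1), discretisability (landed), Markov (R2′)
  obtain ⟨Ψ, h1, h2, h3⟩ := hR1
  have h4 : ∀ D : DobrushinDomain, ∃ E : ℝ → DiscreteDobrushin, ZdDiscretisationFamily D E :=
    stub_discretisable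
  have hM : ∀ ν ∈ subseqQuadLimits (Set.univ : Set ℂ), ChordalFamily.IsDomainMarkov
      (fun D => (ν : Measure (QuadConfig (Set.univ : Set ℂ))).map (Ψ D)) :=
    fun ν hν => isDomainMarkov_map_of_limitMarkov hR2 Ψ h1 h3 h4 hν
  -- carrier dependence from Markov, then locality / target independence (landed passage)
  have hcar : ∀ ν ∈ subseqQuadLimits (Set.univ : Set ℂ), ∀ D D' : DobrushinDomain,
      D'.carrier = D.carrier → D'.pt 0 = D.pt 0 → D'.pt 1 = D.pt 1 →
        (ν : Measure (QuadConfig (Set.univ : Set ℂ))).map (Ψ D') =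
          (ν : Measure (QuadConfig (Set.univ : Set ℂ))).map (Ψ D) :=
    fun ν hν D D' hc h0 h1' =>
      map_eq_of_isDomainMarkov_of_carrier_eq (P := fun G =>
        (ν : Measure (QuadConfig (Set.univ : Set ℂ))).map (Ψ G)) (hM ν hν) hc h0 h1'
  obtain ⟨hloc, hti⟩ := stub_localityPassage2 Ψ h1 h3 h4 hcar stub_discreteLocality
    stub_discreteSplitting μ hμ
  -- chordality (landed), covariance (landed; the ONLY use of the antecedents)
  have hch := isChordal_of_handsOff Ψ h1 h3 h4 μ hμ
  have hcov := stub_covarianceFromDictionary Ψ h1 h2 μ (hRot μ hμ) (hScale μ hμ)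
    (stub_translationInput μ hμ)
  -- convergence of the interface laws to `(Ψ D)_* μ` (curve marginal of the hands-off)
  have hcv : ∀ (D : DobrushinDomain) (E : ℝ → DiscreteDobrushin), ZdDiscretisationFamily D E →
      ∀ f : CurveClass ℂ →ᵇ ℝ,
        Tendsto (fun n => ∫ ω, f (bondInterfaceIn D (E (δs (φ n))) ω)
          ∂(bondPercolation (zdGraph 2) half)) atTop
          (𝓝 (∫ γ, f γ ∂((μ : Measure (QuadConfig (Set.univ : Set ℂ))).map (Ψ D)))) := by
    intro D E hE f
    have h := h3 μ (δs ∘ φ) (fun n => hpos (φ n)) (hlim.comp hφ.tendsto_atTop) hconv D E hE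
      (f.compContinuous ⟨Prod.snd, continuous_snd⟩)
    rw [integral_map (h1 D).aemeasurable f.continuous.aestronglyMeasurable]
    simpa only [BoundedContinuousFunction.compContinuous_apply, ContinuousMap.coe_mk,
      Function.comp_apply] using h
  -- no boundary tracing: landed regularity of interface sublimits, for EVERY `D` by `h4`
  have hnt : ∀ D : DobrushinDomain,
      ∀ᵐ γ ∂((μ : Measure (QuadConfig (Set.univ : Set ℂ))).map (Ψ D)), ∀ c : Curve ℂ,
        CurveClass.mk c = γ → ∀ s t : I, s < t → c '' Set.Icc s t ⊆ frontier D.carrier →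
          (c '' Set.Icc s t).Subsingleton := by
    intro D
    obtain ⟨E, hE⟩ := h4 D
    haveI : IsProbabilityMeasure ((μ : Measure (QuadConfig (Set.univ : Set ℂ))).map (Ψ D)) :=
      Measure.isProbabilityMeasure_map (h1 D).aemeasurable
    exact stub_limitCurveRegularity_noTrace D E hE (δs ∘ φ) (fun n => hpos (φ n))
      (hlim.comp hφ.tendsto_atTop) _ (hcv D E hE)
  exact ⟨φ, hφ, fun D => (μ : Measure (QuadConfig (Set.univ : Set ℂ))).map (Ψ D),
    ⟨hch, hcov, hM μ hμ, hloc, hti⟩, hnt, hcv⟩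

/-- **`LagHandOff` from R1 and R2″ (`stub_slitHandOff`: one slit kernel identified along an
antitone closed approximation of every closed stopping set, with a.s. weak left-continuity)**, via
the landed `stub_limitMarkov_of_core` (p122633). -/
theorem lagHandOff_of_quadTransfer_slitHandOff
    (hR1 : ∃ Ψ : DobrushinDomain → QuadConfig (Set.univ : Set ℂ) → CurveClass ℂ,
      (∀ D : DobrushinDomain, Measurable (Ψ D)) ∧
      (∀ (D : DobrushinDomain) (c : ℂ) (hc : c ≠ 0) (w : ℂ) (S : QuadConfig (Set.univ : Set ℂ)),
        Ψ (D.map (similarity c hc w)) (S.mapHomeomorph (similarity c hc w)) =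
          (Ψ D S).map (similarity c hc w : C(ℂ, ℂ))) ∧
      (∀ (μ : FiniteMeasure (QuadConfig (Set.univ : Set ℂ))) (δs : ℕ → ℝ), (∀ n, 0 < δs n) →
        Tendsto δs atTop (𝓝 0) →
        Tendsto (fun n => z2QuadLaw (Set.univ : Set ℂ) (δs n)) atTop (𝓝 μ) →
        ∀ (D : DobrushinDomain) (E : ℝ → DiscreteDobrushin), ZdDiscretisationFamily D E →
          ∀ f : (QuadConfig (Set.univ : Set ℂ) × CurveClass ℂ) →ᵇ ℝ,
            Tendsto (fun n => ∫ ω, f (z2QuadConfig (Set.univ : Set ℂ) (δs n) ω,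
                bondInterfaceIn D (E (δs n)) ω) ∂(bondPercolation (zdGraph 2) half))
              atTop (𝓝 (∫ S, f (S, Ψ D S) ∂(μ : Measure (QuadConfig (Set.univ : Set ℂ)))))))
    (hR2 : ∀ μ ∈ subseqQuadLimits (Set.univ : Set ℂ), ∀ P : ChordalFamily, (∀ δs : ℕ → ℝ, (∀ n, 0 < δs n) → Tendsto δs atTop (𝓝 0) → Tendsto (fun n => z2QuadLaw (Set.univ : Set ℂ) (δs n)) atTop (𝓝 μ) → ∀ (D : DobrushinDomain) (E : ℝ → DiscreteDobrushin), ZdDiscretisationFamily D E → ∀ f : CurveClass ℂ →ᵇ ℝ, Tendsto (fun n => ∫ ω, f (bondInterfaceIn D (E (δs n)) ω) ∂(bondPercolation (zdGraph 2) half)) atTop (𝓝 (∫ γ, f γ ∂(P D)))) → (∀ D : DobrushinDomain, ∃ E : ℝ → DiscreteDobrushin, ZdDiscretisationFamily D E) → ∃ K : Set ℂ → ℂ → ℂ → Measure (CurveClass ℂ), (∀ U x b, IsProbabilityMeasure (K U x b)) ∧ (∀ (D : DobrushinDomain) (T : Set (CurveClass ℂ)), MeasurableSet T → Measurable fun p :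 CurveClass ℂ => K (remainingDomain D p) p.target (D.pt 1) T) ∧ ∀ (D : DobrushinDomain) (F : Set ℂ), IsClosed F → ∃ G : ℕ → Set ℂ, (∀ k, IsClosed (G k)) ∧ Antitone G ∧ (⋂ k, G k) = F ∧ (∀ k, ∀ S T : Set (CurveClass ℂ), MeasurableSet S → MeasurableSet T → P D (CurveClass.stopAt (G k) ⁻¹' S ∩ CurveClass.startFrom (G k) ⁻¹' T) = ∫⁻ γ in CurveClass.stopAt (G k) ⁻¹' S, K (remainingDomain D (γ.stopAt (G k))) (γ.stopAt (G k)).target (D.pt 1) T ∂(P D)) ∧ ∀ g : CurveClass ℂ →ᵇ ℝ, ∀ᵐ γ ∂(P D), Tendsto (fun k => ∫ x, g x ∂(K (remainingDomain D (γ.stopAt (G k))) (γ.stopAt (G k)).target (D.pt 1))) atTop (𝓝 (∫ x, g x ∂(K (remainingDomain D (γ.stopAt F)) (γ.stopAt F).target (D.pt 1))))) :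
    LagHandOff :=
  lagHandOff_of_quadTransfer_limitMarkov hR1 (stub_limitMarkov_of_core hR2)

/-- **The registered skeleton as a theorem: `LagHandOff` from R1 (`stub_quadTransfer`) and R2‴
(`stub_slitHandOffDyadic`: slit identification at the first hitting of every DYADIC POLYGON through
one set-indexed kernel + its a.s. weak continuity along antitone dyadic sequences)**, via the landed
dyadic reduction `stub_slitHandOff_of_dyadic` (p126575).  This is `LagHandOff_of` of
`Cruxes/LagHandOff/Lines/hitting_tournament.lean` with its two `sorry`s turned into hypotheses. -/
theorem lagHandOff_of_stubs : (∃ Ψ : DobrushinDomain → QuadConfig (Set.univ : Set ℂ) → CurveClass ℂ, (∀ D : DobrushinDomain, Measurable (Ψ D)) ∧ (∀ (D : DobrushinDomain) (c : ℂ) (hc : c ≠ 0) (w : ℂ) (S : QuadConfig (Set.univ : Set ℂ)), Ψ (D.map (similarity c hc w)) (S.mapHomeomorph (similarity c hc w)) = (Ψ D S).map (similarity c hc w : C(ℂ, ℂ))) ∧ (∀ (μ : FiniteMeasure (QuadConfig (Set.univ : Set ℂ))) (δs : ℕ → ℝ), (∀ n, 0 < δs n) → Tendsto δs atTop (𝓝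 0) → Tendsto (fun n => z2QuadLaw (Set.univ : Set ℂ) (δs n)) atTop (𝓝 μ) → ∀ (D : DobrushinDomain) (E : ℝ → DiscreteDobrushin), ZdDiscretisationFamily D E → ∀ f : (QuadConfig (Set.univ : Set ℂ) × CurveClass ℂ) →ᵇ ℝ, Tendsto (fun n => ∫ ω, f (z2QuadConfig (Set.univ : Set ℂ) (δs n) ω, bondInterfaceIn D (E (δs n)) ω) ∂(bondPercolation (zdGraph 2) half)) atTop (𝓝 (∫ S, f (S, Ψ D S) ∂(μ : Measure (QuadConfig (Set.univ : Set ℂ))))))) → (∀ μ ∈ subseqQuadLimits (Set.univ : Set ℂ), ∀ P : ChordalFamily, (∀ δs : ℕ → ℝ, (∀ n, 0 < δs n) → Tendsto δs atTop (𝓝 0) → Tendsto (fun n => z2QuadLaw (Set.univ : Set ℂ) (δs n)) atTop (𝓝 μ) → ∀ (D : DobrushinDomain) (E : ℝ → DiscreteDobrushin), ZdDiscretisationFamily D E → ∀ f : CurveClass ℂ →ᵇ ℝ, Tendsto (fun n => ∫ ω, f (bondInterfaceIn D (E (δs n)) ω) ∂(bondPercolation (zdGraph 2) half)) atTop (𝓝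 (∫ γ, f γ ∂(P D)))) → (∀ D : DobrushinDomain, ∃ E : ℝ → DiscreteDobrushin, ZdDiscretisationFamily D E) → ∃ K : Set ℂ → ℂ → ℂ → Measure (CurveClass ℂ), (∀ U x b, IsProbabilityMeasure (K U x b)) ∧ (∀ (D : DobrushinDomain) (T : Set (CurveClass ℂ)), MeasurableSet T → Measurable fun p : CurveClass ℂ => K (remainingDomain D p) p.target (D.pt 1) T) ∧ (∀ (D : DobrushinDomain) (G : Set ℂ), (∃ (n : ℕ) (s : Finset (ℤ × ℤ)), G = ⋃ p ∈ s, {z : ℂ | z.re ∈ Set.Icc ((p.1 : ℝ) / 2 ^ n) (((p.1 : ℝ) + 1) / 2 ^ n) ∧ z.im ∈ Set.Icc ((p.2 : ℝ) / 2 ^ n) (((p.2 : ℝ) + 1) / 2 ^ n)}) → ∀ S T : Set (CurveClass ℂ), MeasurableSet S → MeasurableSet T → P D (CurveClass.stopAt G ⁻¹' S ∩ CurveClass.startFrom G ⁻¹' T) = ∫⁻ γ in CurveClass.stopAt G ⁻¹' S, K (remainingDomain D (γ.stopAt G)) (γ.stopAt G).target (D.pt 1) T ∂(P D)) ∧ ∀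 (D : DobrushinDomain) (G : ℕ → Set ℂ), (∀ k, ∃ (n : ℕ) (s : Finset (ℤ × ℤ)), G k = ⋃ p ∈ s, {z : ℂ | z.re ∈ Set.Icc ((p.1 : ℝ) / 2 ^ n) (((p.1 : ℝ) + 1) / 2 ^ n) ∧ z.im ∈ Set.Icc ((p.2 : ℝ) / 2 ^ n) (((p.2 : ℝ) + 1) / 2 ^ n)}) → Antitone G → ∀ g : CurveClass ℂ →ᵇ ℝ, ∀ᵐ γ ∂(P D), Tendsto (fun k => ∫ x, g x ∂(K (remainingDomain D (γ.stopAt (G k))) (γ.stopAt (G k)).target (D.pt 1))) atTop (𝓝 (∫ x, g x ∂(K (remainingDomain D (γ.stopAt (⋂ k, G k))) (γ.stopAt (⋂ k, G k)).target (D.pt 1))))) → LagHandOff :=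
  fun hR1 hR2 => lagHandOff_of_quadTransfer_slitHandOff hR1 (stub_slitHandOff_of_dyadic hR2)

end Summit.CriticalPhenomena.CardyFormulaZ2.Cruxes.LagHandOff.HittingTournament

end
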